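import Summits.NavierStokesRegularity.NavierStokesRegularity.Theorems.PlanarFluxAPriori.Negative.SlabApexBoundApexFoamProfile
import Summits.NavierStokesRegularity.NavierStokesRegularity.Theorems.PlanarFluxAPriori.Negative.SlabApexBoundApexFoamField
import Summits.NavierStokesRegularity.NavierStokesRegularity.Theorems.SlicedKelvinPlanarFluxAPrioriFoliation
import Literature.Analysis.FluidPDE.NSLocalClassicalProofs

/-!
# `stub_slabApexBound` is false in its kinematic form and from the initial time (apex foam, part 3:
  conclusions; negative-side support for line `Sketch` of the crux `SlicedKelvin.PlanarFluxAPriori`,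
  stmt-NavierStokesRegularity-15600)

Refuter cdisprove seat g2, cycle 1 (2026-08-17). LOAD-BEARING ANALYSIS of the only open stub of skeleton
`Cruxes/PlanarFluxAPriori/Lines/Sketch.lean` (rev 4), `stub_slabApexBound`
(`∀ t₀ ∈ Ioo 0 T, ∃ M h > 0, ∀ t ∈ Ico t₀ T, ∀ R c, liminf_{ε→0⁺} ∫_{|⟪x,Re₂⟫−c|<h} (ε²/√(f²+ε²)³)|Df[curl u(t)]| ≤ M`,
`f = ⟪curl u(t), Re₂⟫`), with the apex-foam witness `v` of parts 1–2 (smooth, compactly supported, divergence free;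
on `B(0,2)`: `curl v = (x₀x₂g'', 1 − x₂g', −g(x₁))`, `g` smooth, SIGN-ALTERNATING across the gaps of
`U = ⋃ₖ(zₖ, bₖ)`, `g(zₖ) = 0 ≠ g(mₖ)`):
* `ApexFoam.liminf_apex_eq_top` — for EVERY `h > 0` the functional of the slab `{|x₂| < h}` (frame `R = 1`,
  height `0`) has `liminf_{ε→0⁺} = ⊤`: on the box `x₁ ∈ [0,1]`, `x₀² + x₂² < h'²` the integrand dominates
  `½·ε²/√(g²+ε²)³|g'|(x₁)` (`Θ_le_G`: the crossing component `1 − x₂g'` is `≥ ½`), Fubini in the swapped frame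
  (`lintegral_Θ`, tree `lintegral_lintegral_foliation`) factors out the cross-section area, and the 1-D fold budget
  charges each of the first `K` folds `≥ ¼` once `ε ≤ min_{k<K} |g(mₖ)|` (part 1); `K → ∞`;
* `slabApexBound_false_kinematic` — the stub's conclusion for a general field `v` under the hypotheses of the
  line's KINEMATIC stubs (`ContDiff ℝ ⊤ v` + cubic decay of `Dᵏv`, `k ≤ 3`) is FALSE;
* `slabApexBound_false_forData` — false even on admissible Clay DATA (smooth, rapidly decaying, divergence free);
* `slabApexBound_false_from_initialTime` — the registered stub with `t₀ ∈ Ico 0 T` in place of `Ioo 0 T`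
  (everything else verbatim) is FALSE: the tree's PROVED local classical Leray–Hopf existence theorem
  (`local_classical_lerayHopf_holds`) run from the witness datum, evaluated at `t = t₀ = 0`.

CONSEQUENCES for the provers. (1) `t₀ > 0` is load-bearing and must enter QUANTITATIVELY (plausibly `M(t₀) ↑ ∞`
as `t₀ ↓ 0` along the solution from this datum: sign-alternating folds of scale `ℓ ≫ √(νt₀)` are stable under
`C¹`-small perturbations — not proved here). (2) No `Cᵏ`, Schwartz or decay norm of a slice controls the
functional (`+∞` on a `C^∞_c` field, `0` on the straight tube `g ≡ 0` nearby): a proof must use positive-time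
STRUCTURE of `ω(t)·n` — analyticity / unique continuation (finitely many folds per compact set) made quantitative
and uniform in `(t, R, c)` and in the far field, i.e. a frequency / nodal-count bound for `ω(t)·n` (in print only
Kukavica's Grashof-polynomial LENGTH bounds for vorticity nodal lines of 2-D NS; nothing for 3-D `ω·n`).
(3) The one-sided foam `g ≥ 0` (`support g = U`) is a witness too (`liminf_apex_eq_top` needs only
`g(zₖ) = 0 ≠ g(mₖ)`): the functional charges TOUCHINGS of `f = 0` at full weight although the regular nodal set
`{f = 0, ∇f ≠ 0}` is then EMPTY — `liminf_ε ∫H_ε'(f)|q|` is the total variation of `sign f` ALONG THE VORTEX LINES,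
not the Γ-weighted area of the regular nodal set; the line card's identification needs `0` to be a regular value
of `f`, which fails on a dense set of `(R, c, t)`.
-/

noncomputable section

-- Problem = summit for this single-conjunct summit: the duplicate namespace component is deliberate.
set_option linter.dupNamespace false

namespace Summit.NavierStokesRegularity.NavierStokesRegularity.Theorems.PlanarFluxAPriori.Negative

open MeasureTheory Set Function Filter Topology Literature.Analysis.FluidPDE
open scoped ENNReal InnerProductSpace RealInnerProductSpace ContDiff

namespace ApexFoam

local notation "E3" => EuclideanSpace ℝ (Fin 3)
local notation "E2" => EuclideanSpace ℝ (Fin 2)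

section Slab
variable {g : ℝ → ℝ}

/-- On the core the stub's integrand is `ofReal (ε²/√(g(x₁)²+ε²)³ · |g'(x₁)| · |1 − x₂g'(x₁)|)`. -/
theorem G_eq_of_mem_ball (hg : ContDiff ℝ ∞ g) (ε : ℝ) {x : E3} (hx : x ∈ Metric.ball (0 : E3) 2) :
    G g ε x = ENNReal.ofReal (ε ^ 2 / Real.sqrt (g (x 1) ^ 2 + ε ^ 2) ^ 3 *
      (|deriv g (x 1)| * |1 - x 2 * deriv g (x 1)|)) := by
  unfold G
  rw [normalVorticity_eq hg hx, fderiv_normalVorticity_apply hg hx, neg_sq, abs_neg, abs_mul]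

/-- The box lies in the core ball (`h' ≤ 1`). -/
theorem Kset_subset_ball {h' : ℝ} (hh' : 0 < h') (hh'1 : h' ≤ 1) :
    Kset h' ⊆ Metric.ball (0 : E3) 2 := by
  intro x ⟨hx1, hx02⟩
  rw [mem_ball_zero_iff]
  have hn : ‖x‖ ^ 2 = x 0 ^ 2 + x 1 ^ 2 + x 2 ^ 2 := by
    rw [EuclideanSpace.norm_sq_eq, Fin.sum_univ_three]; simp [Real.norm_eq_abs, sq_abs]
  have hsq : ‖x‖ ^ 2 < 2 ^ 2 := by
    rw [hn]; nlinarith [hx1.1, hx1.2, sq_nonneg (x 1 - 1), sq_nonneg h']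
  exact (abs_lt_of_sq_lt_sq' hsq (by norm_num)).2

/-- On the box `|x₂| < h'`. -/
theorem abs_two_lt_of_mem_Kset {h' : ℝ} (hh' : 0 < h') {x : E3} (hx : x ∈ Kset h') : |x 2| < h' :=
  abs_lt_of_sq_lt_sq (by nlinarith [hx.2, sq_nonneg (x 0)]) hh'.le

/-- **Pointwise minoration** `Θ ≤ G`: on the box the vorticity component `ω₁ = 1 − x₂ g'(x₁)` crossing the
fold sheets is at least `1/2`. -/
theorem Θ_le_G (hg : ContDiff ℝ ∞ g) {C' h' : ℝ} (hC : ∀ s, |deriv g s| ≤ C') (hh' : 0 < h')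
    (hh'1 : h' ≤ 1) (hh'C : 2 * h' * C' ≤ 1) (ε : ℝ) (x : E3) : Θ g ε h' x ≤ G g ε x := by
  unfold Θ
  by_cases hx : x ∈ Kset h'
  · rw [indicator_of_mem hx, G_eq_of_mem_ball hg ε (Kset_subset_ball hh' hh'1 hx)]
    refine ENNReal.ofReal_le_ofReal ?_
    change apexDensity ε g (x 1) / 2 ≤ _
    have hx2 : |x 2| < h' := abs_two_lt_of_mem_Kset hh' hx
    have hprod : |x 2 * deriv g (x 1)| ≤ 1 / 2 := by
      rw [abs_mul]; nlinarith [mul_le_mul hx2.le (hC (x 1)) (abs_nonneg _) hh'.le]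
    have hfac : 1 / 2 ≤ |1 - x 2 * deriv g (x 1)| :=
      (show (1 : ℝ) / 2 ≤ 1 - x 2 * deriv g (x 1) by
        linarith [le_abs_self (x 2 * deriv g (x 1))]).trans (le_abs_self _)
    have hD : 0 ≤ apexDensity ε g (x 1) := apexDensity_nonneg _ _ _
    calc apexDensity ε g (x 1) / 2 = apexDensity ε g (x 1) * (1 / 2) := by ring
      _ ≤ apexDensity ε g (x 1) * |1 - x 2 * deriv g (x 1)| := mul_le_mul_of_nonneg_left hfac hD
      _ = _ := by unfold apexDensity; ring
  · rw [indicator_of_notMem hx]; exact bot_le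

/-- The minorant is supported in the slab `{|x₂| < h}` once `h' ≤ h`. -/
theorem support_Θ_subset {ε h h' : ℝ} (hh' : 0 < h') (hh'h : h' ≤ h) :
    support (Θ g ε h') ⊆ {x : E3 | |⟪x, e 2⟫ - 0| < h} := by
  intro x hx
  have hxK : x ∈ Kset h' := support_indicator_subset hx
  have h2 : |x 2| < h' := abs_two_lt_of_mem_Kset hh' hxK
  simp only [mem_setOf_eq, e, EuclideanSpace.inner_single_right, sub_zero]
  simpa using h2.trans_le hh'h

/-- The box is measurable. -/
theorem measurableSet_Kset (h' : ℝ) : MeasurableSet (Kset h') := by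
  have h1 : MeasurableSet {x : E3 | x 1 ∈ Icc (0 : ℝ) 1} :=
    measurableSet_Icc.preimage (P 1).continuous.measurable
  have h2 : IsOpen {x : E3 | x 0 ^ 2 + x 2 ^ 2 < h' ^ 2} :=
    isOpen_lt (((P 0).continuous.pow 2).add ((P 2).continuous.pow 2)) continuous_const
  exact h1.inter h2.measurableSet

/-- The minorant is measurable. -/
theorem measurable_Θ (hg : ContDiff ℝ ∞ g) (ε h' : ℝ) : Measurable (Θ g ε h') := by
  refine Measurable.indicator ?_ (measurableSet_Kset h')
  have hc : Continuous fun x : E3 => apexDensity ε g (x 1) / 2 :=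
    ((continuous_apexDensity ε (hg.of_le (by norm_cast))).comp' (P 1).continuous).div_const 2
  exact (hc.measurable.ennreal_ofReal :)

/-- `‖y‖ < h' ↔ y₀² + y₁² < h'²` in `ℝ²` (`h' > 0`). -/
theorem norm_lt_iff_E2 {h' : ℝ} (hh' : 0 < h') (y : E2) : ‖y‖ < h' ↔ y 0 ^ 2 + y 1 ^ 2 < h' ^ 2 := by
  rw [EuclideanSpace.norm_eq, Real.sqrt_lt' hh', Fin.sum_univ_two, Real.norm_eq_abs, Real.norm_eq_abs]; simp

/-- In the swapped foliation chart the minorant is a product: (cross-section indicator) × (1-D fold density). -/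
theorem Θ_chart (ε : ℝ) {h' : ℝ} (hh' : 0 < h') (c : ℝ) (y : E2) :
    Θ g ε h' (Rsw (WithLp.toLp 2 ![y 0, y 1, c])) =
      (Metric.ball (0 : E2) h').indicator 1 y *
        (Icc (0 : ℝ) 1).indicator (fun c => ENNReal.ofReal (apexDensity ε g c / 2)) c := by
  rw [Rsw_apply]
  simp only [Θ, Kset, indicator, mem_setOf_eq, mem_ball_zero_iff, norm_lt_iff_E2 hh', Pi.one_apply]
  by_cases hc : c ∈ Icc (0 : ℝ) 1 <;> by_cases hy : y 0 ^ 2 + y 1 ^ 2 < h' ^ 2 <;> simp [hc, hy, apexDensity]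

/-- **Fubini**: the integral of the minorant factorises into the cross-section area and the 1-D fold
budget. -/
theorem lintegral_Θ (hg : ContDiff ℝ ∞ g) (ε : ℝ) {h' : ℝ} (hh' : 0 < h') :
    ∫⁻ x, Θ g ε h' x = volume (Metric.ball (0 : E2) h') *
      ∫⁻ s in Icc (0 : ℝ) 1, ENNReal.ofReal (apexDensity ε g s / 2) := by
  rw [← Summit.NavierStokesRegularity.NavierStokesRegularity.Theorems.SlicedKelvinPlanarFluxAPriori.lintegral_lintegral_foliation
    Rsw (Θ g ε h') (measurable_Θ hg ε h')]
  simp_rw [Θ_chart ε hh']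
  have hB : Measurable fun c : ℝ => (Icc (0 : ℝ) 1).indicator
      (fun c => ENNReal.ofReal (apexDensity ε g c / 2)) c :=
    ((continuous_apexDensity ε (hg.of_le (by norm_cast))).div_const 2).measurable.ennreal_ofReal.indicator
      measurableSet_Icc
  have hA : Measurable fun y : E2 => (Metric.ball (0 : E2) h').indicator (1 : E2 → ℝ≥0∞) y :=
    measurable_one.indicator measurableSet_ball
  calc ∫⁻ c : ℝ, ∫⁻ y : E2, (Metric.ball (0 : E2) h').indicator 1 y *
          (Icc (0 : ℝ) 1).indicator (fun c => ENNReal.ofReal (apexDensity ε g c / 2)) c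
      = ∫⁻ c : ℝ, volume (Metric.ball (0 : E2) h') *
          (Icc (0 : ℝ) 1).indicator (fun c => ENNReal.ofReal (apexDensity ε g c / 2)) c := by
        refine lintegral_congr fun c => ?_
        rw [lintegral_mul_const _ hA, lintegral_indicator_one measurableSet_ball]
    _ = _ := by rw [lintegral_const_mul _ hB, lintegral_indicator measurableSet_Icc]

/-- A smooth compactly supported profile has a bounded derivative. -/
theorem exists_bound_deriv (hg : ContDiff ℝ ∞ g) (hgc : HasCompactSupport g) :
    ∃ C' : ℝ, ∀ s, |deriv g s| ≤ C' := by
  obtain ⟨C, hC⟩ := (hg.continuous_deriv (by simp)).bounded_above_of_compact_support hgc.deriv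
  exact ⟨C, fun s => by simpa [Real.norm_eq_abs] using hC s⟩

/-- `|H_ε(w)| = H_ε(|w|)`. -/
theorem abs_Hreg (ε w : ℝ) : |Hreg ε w| = Hreg ε |w| := by
  rw [Hreg, Hreg, abs_div, abs_of_nonneg (Real.sqrt_nonneg _), sq_abs]

/-- Two-sided form of part 1's FTC bound: `|H_ε(g m)|/2 ≤ ∫_{(a,m]} apexDensity/2` when `g a = 0` (apply
`ofReal_Hreg_le_lintegral` to `g` and to `−g`, whose apex densities agree). -/
theorem ofReal_abs_Hreg_le_lintegral {ε : ℝ} (hε : ε ≠ 0) (hg : ContDiff ℝ 1 g) {a m : ℝ} (ham : a ≤ m)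
    (hga : g a = 0) :
    ENNReal.ofReal (|Hreg ε (g m)| / 2) ≤ ∫⁻ s in Ioc a m, ENNReal.ofReal (apexDensity ε g s / 2) := by
  rcases le_or_gt 0 (Hreg ε (g m)) with h | h
  · rw [abs_of_nonneg h]
    exact ofReal_Hreg_le_lintegral hε hg ham hga
  · have hneg : ∀ s, apexDensity ε (fun s => -g s) s = apexDensity ε g s := fun s => by
      have hd : deriv (fun s => -g s) s = -deriv g s := ((hg.differentiable one_ne_zero s).hasDerivAt.neg).deriv
      simp only [apexDensity, hd, abs_neg, neg_sq]
    have h1 := ofReal_Hreg_le_lintegral hε hg.neg ham (show -g a = 0 by rw [hga, neg_zero]) (m := m)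
    simp only [hneg] at h1
    have hodd : Hreg ε (-g m) = -Hreg ε (g m) := by simp [Hreg, neg_div]
    rwa [hodd, ← abs_of_neg h] at h1

/-- **Main estimate.** For the witness built on a smooth nonnegative profile `g` with `support g = U`, the
ε-apex functional of every slab `{|x₂| < h}` (frame `R = 1`, height `c = 0`) has `liminf_{ε→0⁺} = ⊤`. -/
theorem liminf_apex_eq_top (hg : ContDiff ℝ ∞ g) (hgc : HasCompactSupport g) (hz : ∀ k, g (za k) = 0)
    (hm : ∀ k, g (zm k) ≠ 0) {h : ℝ} (hh : 0 < h) :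
    Filter.liminf (fun ε : ℝ => ∫⁻ x in {x : E3 | |⟪x, e 2⟫ - 0| < h}, G g ε x) (𝓝[>] 0) = ⊤ := by
  obtain ⟨C', hC'⟩ := exists_bound_deriv hg hgc
  have hC0 : 0 ≤ C' := (abs_nonneg _).trans (hC' 0)
  -- the resolution of the box
  set h' : ℝ := min (min h 1) (1 / (2 * (C' + 1))) with hh'def
  have hh'pos : 0 < h' := lt_min (lt_min hh one_pos) (by positivity)
  have hh'h : h' ≤ h := (min_le_left _ _).trans (min_le_left _ _)
  have hh'1 : h' ≤ 1 := (min_le_left _ _).trans (min_le_right _ _)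
  have hh'C : 2 * h' * C' ≤ 1 := by
    have h1 : h' ≤ 1 / (2 * (C' + 1)) := min_le_right _ _
    rw [le_div_iff₀ (by positivity)] at h1
    nlinarith
  have hg1 : ContDiff ℝ 1 g := hg.of_le (by norm_cast)
  set V : ℝ≥0∞ := volume (Metric.ball (0 : E2) h') with hV
  have hVpos : V ≠ 0 := (Metric.measure_ball_pos volume (0 : E2) hh'pos).ne'
  -- K folds are charged once ε ≤ min_{k<K} g(m_k)
  have hK : ∀ K : ℕ, V * ((K : ℝ≥0∞) * ENNReal.ofReal (1 / 4)) ≤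
      Filter.liminf (fun ε : ℝ => ∫⁻ x in {x : E3 | |⟪x, e 2⟫ - 0| < h}, G g ε x) (𝓝[>] 0) := by
    intro K
    have hev : ∀ᶠ ε in 𝓝[>] (0 : ℝ), 0 < ε ∧ ∀ k ∈ Finset.range K, ε ≤ |g (zm k)| := by
      refine (eventually_mem_nhdsWithin).and ?_
      rw [Filter.eventually_all_finset]
      intro k _
      exact mem_nhdsWithin_of_mem_nhds (Iic_mem_nhds (abs_pos.2 (hm k)))
    refine le_liminf_of_le (by isBoundedDefault) ?_
    filter_upwards [hev] with ε ⟨hε, hεK⟩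
    have hterm : ∀ k ∈ Finset.range K, ENNReal.ofReal (1 / 4) ≤
        ∫⁻ s in Ioc (za k) (zm k), ENNReal.ofReal (apexDensity ε g s / 2) := by
      intro k hk
      refine le_trans ?_ (ofReal_abs_Hreg_le_lintegral hε.ne' hg1 (za_lt_zm k).le (hz k))
      refine ENNReal.ofReal_le_ofReal ?_
      have := half_le_Hreg hε (hεK k hk)
      rw [← abs_Hreg] at this
      linarith
    calc V * ((K : ℝ≥0∞) * ENNReal.ofReal (1 / 4))
        = V * ∑ k ∈ Finset.range K, ENNReal.ofReal (1 / 4) := by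
          rw [Finset.sum_const, Finset.card_range, nsmul_eq_mul]
      _ ≤ V * ∑ k ∈ Finset.range K, ∫⁻ s in Ioc (za k) (zm k), ENNReal.ofReal (apexDensity ε g s / 2) := by
          gcongr with k hk
          exact hterm k hk
      _ ≤ V * ∫⁻ s in Icc (0 : ℝ) 1, ENNReal.ofReal (apexDensity ε g s / 2) := by
          gcongr
          exact sum_lintegral_le_lintegral_Icc _ K
      _ = ∫⁻ x, Θ g ε h' x := (lintegral_Θ hg ε hh'pos).symm
      _ = ∫⁻ x in {x : E3 | |⟪x, e 2⟫ - 0| < h}, Θ g ε h' x :=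
          (setLIntegral_eq_of_support_subset (support_Θ_subset hh'pos hh'h)).symm
      _ ≤ ∫⁻ x in {x : E3 | |⟪x, e 2⟫ - 0| < h}, G g ε x :=
          lintegral_mono (Θ_le_G hg hC' hh'pos hh'1 hh'C ε)
  -- let K → ∞
  have hc : V * ENNReal.ofReal (1 / 4) ≠ 0 := mul_ne_zero hVpos (by simp)
  rw [eq_top_iff]
  calc (⊤ : ℝ≥0∞) = V * ENNReal.ofReal (1 / 4) * ⊤ := (ENNReal.mul_top hc).symm
    _ = V * ENNReal.ofReal (1 / 4) * ⨆ K : ℕ, (K : ℝ≥0∞) := by rw [ENNReal.iSup_natCast]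
    _ = ⨆ K : ℕ, V * ENNReal.ofReal (1 / 4) * (K : ℝ≥0∞) := ENNReal.mul_iSup _ _
    _ ≤ _ := iSup_le fun K => by
        calc V * ENNReal.ofReal (1 / 4) * (K : ℝ≥0∞) = V * ((K : ℝ≥0∞) * ENNReal.ofReal (1 / 4)) := by ring
          _ ≤ _ := hK K

/-- `zb k ≤ za j` for `j < k`: the intervals `(za ·, zb ·)` are ordered from right to left. -/
theorem zb_le_za_of_lt {j k : ℕ} (h : j < k) : zb k ≤ za j := by
  unfold zb za
  have h' : (j : ℝ) + 1 ≤ k := by exact_mod_cast h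
  rw [div_le_div_iff₀ (by positivity) (by positivity)]; nlinarith

/-- The peak `mₖ` lies in no other interval. -/
theorem zm_not_mem_Ioo {j k : ℕ} (h : j ≠ k) : zm k ∉ Ioo (za j) (zb j) := by
  rintro ⟨h1, h2⟩
  rcases lt_or_gt_of_ne h with hjk | hkj
  · exact lt_irrefl _ ((((zm_lt_zb k).trans_le (zb_le_za_of_lt hjk))).trans h1)
  · exact lt_irrefl _ ((h2.trans_le (zb_le_za_of_lt hkj)).trans (za_lt_zm k))

/-- **The witness.** A smooth, compactly supported, divergence-free (hence rapidly decaying) field on `ℝ³` whose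
ε-apex functional is infinite on every slab `{|x₂| < h}` (frame `R = 1`, height `0`). Profile: the SIGN-ALTERNATING
foam `g = g₊ − g₋`, `support g₊ = ⋃ᵢ (z₂ᵢ, b₂ᵢ)`, `support g₋ = ⋃ᵢ (z₂ᵢ₊₁, b₂ᵢ₊₁)` (`IsOpen.exists_contDiff_support_eq`),
so the normal vorticity `−g(x₁)` changes sign across every gap (the one-sided foam `g ≥ 0` works verbatim). -/
theorem apexFoam_witness :
    ∃ v : E3 → E3, ContDiff ℝ (⊤ : ℕ∞) v ∧ HasCompactSupport v ∧ VectorCalculus.IsDivFree v ∧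
      HasRapidSpatialDecay v ∧
      (∃ C : ℝ, ∀ (x : E3) (k : ℕ), k ≤ 3 → (1 + ‖x‖) ^ 3 * ‖iteratedFDeriv ℝ k v x‖ ≤ C) ∧
      ∀ h : ℝ, 0 < h →
        Filter.liminf (fun ε : ℝ => ∫⁻ x in {x : E3 |
            |inner ℝ x ((LinearIsometryEquiv.refl ℝ E3) (EuclideanSpace.single 2 1)) - 0| < h},
          ENNReal.ofReal (ε ^ 2 / Real.sqrt (inner ℝ (curl v x)
            ((LinearIsometryEquiv.refl ℝ E3) (EuclideanSpace.single 2 1)) ^ 2 + ε ^ 2) ^ 3 *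
            |fderiv ℝ (fun z => inner ℝ (curl v z) ((LinearIsometryEquiv.refl ℝ E3)
              (EuclideanSpace.single 2 1))) x (curl v x)|)) (nhdsWithin 0 (Set.Ioi 0)) = ⊤ := by
  -- the two half-patterns and their profiles
  set W : ℕ → Set ℝ := fun r => ⋃ i : ℕ, Ioo (za (2 * i + r)) (zb (2 * i + r)) with hW
  have hWo : ∀ r, IsOpen (W r) := fun r => isOpen_iUnion fun _ => isOpen_Ioo
  have hWU : ∀ r, W r ⊆ Icc 0 1 := fun r s hs => by
    obtain ⟨i, hi⟩ := mem_iUnion.1 hs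
    have hU := U_subset (mem_iUnion.2 ⟨2 * i + r, hi⟩)
    exact ⟨hU.1.le, hU.2.trans (by norm_num)⟩
  obtain ⟨gp, hgps, hgp, -⟩ := (hWo 0).exists_contDiff_support_eq (n := ⊤)
  obtain ⟨gn, hgns, hgn, -⟩ := (hWo 1).exists_contDiff_support_eq (n := ⊤)
  have hcs : ∀ {f : ℝ → ℝ} {r : ℕ}, f.support = W r → HasCompactSupport f := fun {f r} hf =>
    HasCompactSupport.intro (isCompact_Icc (a := (0 : ℝ)) (b := 1)) fun s hs => by
      by_contra h
      exact hs (hWU r (hf ▸ (mem_support.2 h)))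
  -- values at the zeros and at the peaks
  have hza : ∀ {f : ℝ → ℝ} {r : ℕ}, f.support = W r → ∀ k, f (za k) = 0 := fun {f r} hf k => by
    rw [← notMem_support, hf]
    intro hk
    obtain ⟨i, hi⟩ := mem_iUnion.1 hk
    exact za_not_mem_U k (mem_iUnion.2 ⟨_, hi⟩)
  have hzm0 : ∀ {f : ℝ → ℝ} (r : ℕ), r ≤ 1 → f.support = W r → ∀ i, f (zm (2 * i + (1 - r))) = 0 := by
    intro f r hr hf i
    rw [← notMem_support, hf]
    intro hk
    obtain ⟨i', hi'⟩ := mem_iUnion.1 hk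
    exact zm_not_mem_Ioo (by omega) hi'
  have hzm1 : ∀ {f : ℝ → ℝ} {r : ℕ}, f.support = W r → ∀ i, f (zm (2 * i + r)) ≠ 0 := by
    intro f r hf i
    rw [← mem_support, hf]
    exact mem_iUnion.2 ⟨i, za_lt_zm _, zm_lt_zb _⟩
  set g : ℝ → ℝ := fun s => gp s - gn s with hgdef
  have hg : ContDiff ℝ ∞ g := hgp.sub hgn
  have hgc : HasCompactSupport g := (hcs hgps).sub (hcs hgns)
  have hz : ∀ k, g (za k) = 0 := fun k => by simp [hgdef, hza hgps k, hza hgns k]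
  have hm : ∀ k, g (zm k) ≠ 0 := fun k => by
    obtain ⟨i, rfl | rfl⟩ := Nat.even_or_odd' k
    · have h1 := hzm1 hgps i
      have h2 := hzm0 1 le_rfl hgns i
      simp only [add_zero, Nat.sub_self] at h1 h2
      simpa [hgdef, h2] using h1
    · have h1 := hzm1 hgns i
      have h2 := hzm0 0 (Nat.zero_le 1) hgps i
      simp only [Nat.sub_zero] at h2
      simp [hgdef, h2, h1]
  refine ⟨vfield g, contDiff_vfield hg, hasCompactSupport_vfield, isDivFree_vfield hg,
    hasRapidSpatialDecay_vfield hg, cubicDecay_vfield hg, fun h hh => ?_⟩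
  exact liminf_apex_eq_top hg hgc hz hm hh

end Slab

end ApexFoam

local notation "E3" => EuclideanSpace ℝ (Fin 3)

/-- **`stub_slabApexBound` is false in its kinematic form.** The conclusion of the registered stub
`stub_slabApexBound` of line `Sketch` (crux `SlicedKelvin.PlanarFluxAPriori`) with the Navier–Stokes slice `u t`
replaced by an arbitrary field `v` satisfying the hypotheses of the line's KINEMATIC stubs (`stub_apexLipschitz`,
`stub_slabSplit`: smoothness and cubic decay of `Dᵏv`, `k ≤ 3`) FAILS: smoothness and decay of a time slice do
not control the ε-apex functional. [folklore] -/
theorem slabApexBound_false_kinematic :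
    ¬ (∀ (v : E3 → E3), ContDiff ℝ (⊤ : ℕ∞) v →
      (∃ C : ℝ, ∀ (x : E3) (k : ℕ), k ≤ 3 → (1 + ‖x‖) ^ 3 * ‖iteratedFDeriv ℝ k v x‖ ≤ C) →
      ∃ M : NNReal, ∃ h : ℝ, 0 < h ∧ ∀ (R : E3 ≃ₗᵢ[ℝ] E3) (c : ℝ),
        Filter.liminf (fun ε : ℝ => ∫⁻ x in {x : E3 | |inner ℝ x (R (EuclideanSpace.single 2 1)) - c| < h},
          ENNReal.ofReal (ε ^ 2 / Real.sqrt (inner ℝ (curl v x) (R (EuclideanSpace.single 2 1)) ^ 2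
            + ε ^ 2) ^ 3 *
            |fderiv ℝ (fun z => inner ℝ (curl v z) (R (EuclideanSpace.single 2 1))) x (curl v x)|))
          (nhdsWithin 0 (Set.Ioi 0)) ≤ (M : ENNReal)) := by
  intro H
  obtain ⟨v, hv, -, -, -, hdec, htop⟩ := ApexFoam.apexFoam_witness
  obtain ⟨M, h, hh, hM⟩ := H v hv hdec
  have h1 := hM (LinearIsometryEquiv.refl ℝ _) 0
  rw [htop h hh] at h1
  exact ENNReal.coe_ne_top (top_le_iff.1 h1)

/-- **… and false on the class of admissible Navier–Stokes DATA.** The same conclusion fails for a smooth,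
rapidly decaying (indeed compactly supported), divergence-free field — an admissible Clay datum: finiteness of
the apex functional along a solution can only come from properties of POSITIVE-time slices. [folklore] -/
theorem slabApexBound_false_forData :
    ¬ (∀ (v : E3 → E3), ContDiff ℝ (⊤ : ℕ∞) v → HasRapidSpatialDecay v → VectorCalculus.IsDivFree v →
      ∃ M : NNReal, ∃ h : ℝ, 0 < h ∧ ∀ (R : E3 ≃ₗᵢ[ℝ] E3) (c : ℝ),
        Filter.liminf (fun ε : ℝ => ∫⁻ x in {x : E3 | |inner ℝ x (R (EuclideanSpace.single 2 1)) - c| < h},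
          ENNReal.ofReal (ε ^ 2 / Real.sqrt (inner ℝ (curl v x) (R (EuclideanSpace.single 2 1)) ^ 2
            + ε ^ 2) ^ 3 *
            |fderiv ℝ (fun z => inner ℝ (curl v z) (R (EuclideanSpace.single 2 1))) x (curl v x)|))
          (nhdsWithin 0 (Set.Ioi 0)) ≤ (M : ENNReal)) := by
  intro H
  obtain ⟨v, hv, -, hdiv, hdecay, -, htop⟩ := ApexFoam.apexFoam_witness
  obtain ⟨M, h, hh, hM⟩ := H v hv hdecay hdiv
  have h1 := hM (LinearIsometryEquiv.refl ℝ _) 0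
  rw [htop h hh] at h1
  exact ENNReal.coe_ne_top (top_le_iff.1 h1)

/-- **`t₀ > 0` is load-bearing in `stub_slabApexBound`.** The registered stub with the base time allowed to be
the initial time (`t₀ ∈ Set.Ico 0 T` in place of `Set.Ioo 0 T`, everything else verbatim) is FALSE: run the
tree's local classical Leray–Hopf existence theorem (`local_classical_lerayHopf_holds`) from the witness datum
and evaluate at `t = t₀ = 0`. [folklore] -/
theorem slabApexBound_false_from_initialTime :
    ¬ (∀ (ν T : ℝ), 0 < ν → 0 < T → ∀ (u : ℝ → E3 → E3) (p : ℝ → E3 → ℝ),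
      IsClassicalNSSolutionOn (Set.Ico 0 T) ν 0 u p → IsLerayHopfOn T ν 0 (u 0) u →
      HasRapidSpatialDecay (u 0) →
      ∀ t₀ ∈ Set.Ico 0 T, ∃ M : NNReal, ∃ h : ℝ, 0 < h ∧ ∀ t ∈ Set.Ico t₀ T,
        ∀ (R : E3 ≃ₗᵢ[ℝ] E3) (c : ℝ),
        Filter.liminf (fun ε : ℝ => ∫⁻ x in {x : E3 | |inner ℝ x (R (EuclideanSpace.single 2 1)) - c| < h},
          ENNReal.ofReal (ε ^ 2 / Real.sqrt (inner ℝ (curl (u t) x) (R (EuclideanSpace.single 2 1)) ^ 2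
            + ε ^ 2) ^ 3 *
            |fderiv ℝ (fun z => inner ℝ (curl (u t) z) (R (EuclideanSpace.single 2 1))) x (curl (u t) x)|))
          (nhdsWithin 0 (Set.Ioi 0)) ≤ (M : ENNReal)) := by
  intro H
  obtain ⟨v, hv, -, hdiv, hdecay, -, htop⟩ := ApexFoam.apexFoam_witness
  obtain ⟨T, hT, u, p, hcl, hu0, hLH⟩ := local_classical_lerayHopf_holds 1 one_pos v hv hdiv hdecay
  rw [← hu0] at hLH hdecay
  obtain ⟨M, h, hh, hM⟩ := H 1 T one_pos hT u p hcl hLH hdecay 0 ⟨le_rfl, hT⟩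
  have h1 := hM 0 ⟨le_rfl, hT⟩ (LinearIsometryEquiv.refl ℝ _) 0
  rw [hu0, htop h hh] at h1
  exact ENNReal.coe_ne_top (top_le_iff.1 h1)

end Summit.NavierStokesRegularity.NavierStokesRegularity.Theorems.PlanarFluxAPriori.Negative

end
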